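import Summits.AtomisticToContinuum.Crystallization.Theses.PhononSlackCertificates
import Summits.AtomisticToContinuum.Crystallization.Theorems.ReggeStarCoercivityDefectFreeCrystallizesSqueezeToLayeredA
import Summits.AtomisticToContinuum.Crystallization.Theorems.ReggeStarCoercivityStarCoercivityTwoShellGoodStarGood
import Summits.AtomisticToContinuum.Crystallization.Theorems.PhononSlackCertificatesHullBridgeWindows

/-!
# `HullBridge` (route `PhononSlackCertificates`), line `Sketch`, stub S1: the bad fraction vanishes

Support file for item stmt-AtomisticToContinuum-15147 (`HullBridge : CoerciveTwoShellGap →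
NearFieldConvexity → layered windows of every Lennard-Jones ground-state sequence`); first counting
step of the line's skeleton. Along Lennard-Jones ground states `x N`, the coercive two-shell gap,
applied at the uniform minimal distance `δ` of `LennardJonesMinimalDistance_holds`, prices every
`1/20`-bad particle at `g > 0` above `N·e*`, while `(E(x N) − N·e*)/N → 0`
(`PrestressSplitKorn.squeeze_tendsto_excess_div`, i.e. the proved `crysEnergyLimit`); hence
`#{i : ¬ 1/20-good}/N ≤ ((E(x N) − N·e*)/N)/g → 0` (`squeeze_zero`).
-/

noncomputable section

open scoped BigOperators Classical
open Filter Topology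

namespace Summit.AtomisticToContinuum.Crystallization.Theorems.HullBridgeExact

open Summit.AtomisticToContinuum.Crystallization.Theses.PhononSlackCertificates
open Summit.AtomisticToContinuum.Crystallization.Theorems.PrestressSplitKorn
open Summit.AtomisticToContinuum.Crystallization.Theorems.DefectFreeCrystallizes.Negative.PredicateAPI (Good)
open Literature.MathematicalPhysics.StatisticalMechanics Literature.Geometry.DiscreteGeometry

local notation "E3" => EuclideanSpace ℝ (Fin 3)

/-- Pointwise arithmetic of the counting step: if `N·e + g·B ≤ E` with `g > 0`, then
`B/N ≤ ((E − N·e)/N)/g` (for `N = 0` both sides vanish, `x/0 = 0`). [folklore] -/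
theorem bf_div_le {g B E e : ℝ} (N : ℕ) (hg : 0 < g) (h : (N : ℝ) * e + g * B ≤ E) :
    B / N ≤ ((E - (N : ℝ) * e) / N) / g := by
  rw [div_right_comm]
  exact div_le_div_of_nonneg_right ((le_div_iff₀ hg).2 (by linarith)) (Nat.cast_nonneg N)

/-- **S1 — the bad fraction vanishes.** Along a sequence of Lennard-Jones ground states,
`CoerciveTwoShellGap` (at the separation `δ` of `LennardJonesMinimalDistance_holds`) and the `o(N)`
energy budget `squeeze_tendsto_excess_div` give `#{i : ¬ IsTwoShellGood (1/20) (47/50) 1 (x N) i}/N → 0`. -/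
theorem stub_badFraction (hCG : CoerciveTwoShellGap) (x : (N : ℕ) → (Fin N → E3))
    (hx : ∀ N, IsGroundState lennardJones (x N)) :
    Tendsto (fun N : ℕ =>
      (Nat.card {i : Fin N // ¬ IsTwoShellGood (1 / 20) (47 / 50) 1 (x N) i} : ℝ) / N) atTop (𝓝 0) := by
  obtain ⟨δ, hδ, hsep⟩ := LennardJonesMinimalDistance_holds
  obtain ⟨g, hg, hgap⟩ := hCG δ hδ
  have hlim : Tendsto (fun N : ℕ => (interactionEnergy lennardJones (x N) -
      (N : ℝ) * (⨅ Q : PeriodicConfiguration 3, Q.energyPerParticle lennardJones)) / N / g)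
      atTop (𝓝 0) := by
    simpa only [zero_div] using (squeeze_tendsto_excess_div x hx).div_const g
  refine squeeze_zero (fun N => by positivity) (fun N => ?_) hlim
  exact bf_div_le N hg (hgap N (x N) (hsep N (x N) (hx N)))

end Summit.AtomisticToContinuum.Crystallization.Theorems.HullBridgeExact

end
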